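import Summits.QuantumAdvantage.QuantumAdvantage.Theorems.LinnikCubicClassGroupsDegreeOnePrimesEscapeLowerPIT
import Summits.QuantumAdvantage.QuantumAdvantage.Theorems.LinnikCubicClassGroupsDegreeOnePrimesEscapePerCharacterDeficitLocal
import Literature.NumberTheory.LFunctions.ClassGroupLogFreeTheorem14AllDegrees
import Literature.NumberTheory.LFunctions.DedekindZeta1LogFreeTheorem14AllDegrees
import Literature.NumberTheory.LFunctions.DedekindResidueCondQnLowerBound
import HarnessLib

/-!
# T4 and T5 of the cell, HYPOTHESIS-FREE for every number field of a given degree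

Topic `Summits/QuantumAdvantage/QuantumAdvantage/Theorems`, cell B2b-1 (linnik-cubic), PART B (seat 4), serving
the crux `DegreeOnePrimesEscape` (stmt-QuantumAdvantage-11543) of route `LinnikCubicClassGroups` as a helper.
HONEST FRAMING: the value of this file is a THEOREM (kernel-checked) — NOT summit progress.

The cell's degree-local prime-ideal theorems carry the residue hypothesis `condQn K ^ (−A) ≤ κ_K`
(`lowerPIT_of_density_local` = T5, `perCharacterDeficit_of_density_local` = T4), which the cell so far
discharged only for fields WITHOUT a quadratic subfield (Stark, `Residue.condQn_rpow_neg_ten_le_residue`) or for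
`n = 3`.  With the all-fields residue bound
`ThornerZaman.exists_condQn_rpow_neg_le_residue` (Literature, `DedekindResidueCondQnLowerBound.lean`: class
number formula + regulator lower bound, `κ_K ≥ Q^{−A(n)}` for EVERY `K` of degree `n`) and PART A's all-degree
log-free zero-density estimates (`logFreeDensity_dedekindZeta₁_all`, `logFreeDensity_classGroup_all`) both become
unconditional for every number field of every degree `n > 1`:

* `lowerPIT_allFields (n) (hn)` — **one-sided Linnik-type lower prime ideal theorem**: there is `C₁ = C₁(n)` with,
  for every `K` of degree `n` and every `x ≥ Q^{C₁}` (`Q = |d_K| n^n`),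
  `29 Li(x) ≤ 32 π_K(x)` unless `ζ_K` has a real zero `β₁ ∈ (1 − 1/(8 log Q), 1)` with `(1 − β₁) log x < 4`;
* `perCharacterDeficit_allFields (n) (hn)` — **per-character deficit**: there is `C₂ = C₂(n)` with
  `8 Σ_C Re χ(C) π¹_C(x) ≤ Li(x)` for every `K` of degree `n` whose non-trivial class-group `L`-functions
  have no zero on `Re s = 1`… (verbatim the conclusion of `perCharacterDeficit_of_density_local` at `A = A(n)`).
-/

noncomputable section

open scoped NumberField nonZeroDivisors
open Literature.NumberTheory.LFunctions Literature.NumberTheory.LFunctions.NumberField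

namespace Summit.QuantumAdvantage.QuantumAdvantage.Theorems.DegreeOnePrimesEscape

/-- **T5 for every number field of degree `n > 1` (no residue hypothesis, no subfield hypothesis):** there is
`C₁ = C₁(n)` such that for every `K` of degree `n` and every `x ≥ Q^{C₁}`, `29·Li(x) ≤ 32·π_K(x)` or `ζ_K` has a
real zero `β₁ ∈ (1 − 1/(8 log Q), 1)` with `(1 − β₁) log x < 4`
(`lowerPIT_of_density_local` + `logFreeDensity_dedekindZeta₁_all` + `exists_condQn_rpow_neg_le_residue`). -/
theorem lowerPIT_allFields (n : ℕ) (hn : 1 < n) :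
    ∃ C₁ : ℝ, ∀ (K : Type) [Field K] [NumberField K], Module.finrank ℚ K = n →
      ∀ x : ℝ, ThornerZaman.condQn K ^ C₁ ≤ x →
        29 * offsetLogIntegral x ≤ 32 * (primeIdealCount K x : ℝ) ∨
        ∃ β₁ : ℝ, 1 - 1 / (8 * Real.log (ThornerZaman.condQn K)) < β₁ ∧ β₁ < 1 ∧
          dedekindZetaCont K β₁ = 0 ∧ (1 - β₁) * Real.log x < 4 := by
  obtain ⟨A, -, hA⟩ := ThornerZaman.exists_condQn_rpow_neg_le_residue n hn
  obtain ⟨C₁, h⟩ := lowerPIT_of_density_local n hn A (logFreeDensity_dedekindZeta₁_all n)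
  exact ⟨C₁, fun K _ _ hK x hx => h K hK (hA K hK) x hx⟩

/-- **T4 for every number field of degree `n > 1` (no residue hypothesis, no subfield hypothesis):** the
per-character deficit bound `8 Σ_C Re χ(C) π¹_C(x) ≤ Li(x)` for `x ≥ Q^{C₂(n)}`, every `K` of degree `n`, every
non-trivial class-group character `χ`
(`perCharacterDeficit_of_density_local` + `logFreeDensity_classGroup_all` + `exists_condQn_rpow_neg_le_residue`). -/
theorem perCharacterDeficit_allFields (n : ℕ) (hn : 1 < n) :
    ∃ C₂ : ℝ, ∀ (K : Type) [Field K] [NumberField K], Module.finrank ℚ K = n →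
      ∀ χ : ClassGroup (𝓞 K) →* ℂˣ, χ ≠ 1 → ∀ x : ℝ, ThornerZaman.condQn K ^ C₂ ≤ x →
        8 * ∑ C : ClassGroup (𝓞 K), ((χ C : ℂ)).re * (degOneClassCount K C x : ℝ) ≤ offsetLogIntegral x := by
  obtain ⟨A, hA0, hA⟩ := ThornerZaman.exists_condQn_rpow_neg_le_residue n hn
  obtain ⟨C₂, h⟩ := perCharacterDeficit_of_density_local n hn (logFreeDensity_classGroup_all n) A hA0
  exact ⟨C₂, fun K _ _ hK χ hχ x hx => h K hK (hA K hK) χ hχ x hx⟩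

end Summit.QuantumAdvantage.QuantumAdvantage.Theorems.DegreeOnePrimesEscape

end
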